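import Summits.QuantumFields.QCD.Theses.HeatSlicedQuarks
import Summits.QuantumFields.QCD.Theorems.HeatSlicedQuarksInterleavedHeatSliceFlowStubColumnIdentificationAux
import Summits.QuantumFields.QCD.Theorems.HeatSlicedQuarksSmallFieldUltracontractivityFixedPointA
import Summits.QuantumFields.QCD.Theorems.HeatSlicedQuarksSmallFieldUltracontractivityStubRowDuhamel
import Mathlib.Analysis.Normed.Algebra.MatrixExponential
import Mathlib.Analysis.SpecialFunctions.Exponential
import Mathlib.Analysis.Calculus.Deriv.Shift
import Mathlib.MeasureTheory.Integral.IntervalIntegral.FundThmCalculus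

/-!
# Stub `stub_maximalRegularity` of line `Sketch`
(crux `Summit.QuantumFields.QCD.Theses.HeatSlicedQuarks.TracedQuadraticParametrix`, item stmt-QuantumFields-17985)

**Parabolic maximal regularity by freezing** (the log-killer of the line).  For a square complex matrix
`A`, real `a < b`, a vector curve `f` continuous on `[a,b]` with the time-Lipschitz modulus at the
endpoint `‖f(u) − f(b)‖₂ ≤ Λ (b − u)` (`Λ ≥ 0`), the "two derivatives on one kernel" Duhamel integral is
bounded WITHOUT `log (b − a)`:

  `‖∫_a^b A e^{-(b−u)AᴴA} Aᴴ f(u) du‖₂ ≤ 2 ‖f(b)‖₂ + Λ (b − a)/e`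

(the integral is taken entrywise, as `ℂ`-valued interval integrals).

Proof.  Freeze `f(u) = f(b) + (f(u) − f(b))`.
* Frozen part: by the intertwining `e^{-σAᴴA} Aᴴ = Aᴴ e^{-σAAᴴ}`
  (`exp_conjTranspose_mul_self_mul_conjTranspose`) the kernel is
  `A e^{-(b−u)AᴴA} Aᴴ = (AAᴴ) e^{(u−b)AAᴴ} = d/du e^{(u−b)AAᴴ}` (`hasDerivAt_exp_smul_const'`), so by the
  fundamental theorem of calculus, entrywise, `∫_a^b A e^{-(b−u)AᴴA} Aᴴ du = 1 − e^{-(b−a)AAᴴ}`, and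
  `‖(1 − e^{-(b−a)AAᴴ}) f(b)‖₂ ≤ 2‖f(b)‖₂` by the heat contraction for `AAᴴ = (Aᴴ)ᴴAᴴ`
  (`heat_mulVec_contraction`).
* Remainder: for `σ = b − u > 0`, `A e^{-σAᴴA} Aᴴ = (A e^{-(σ/2)AᴴA}) (e^{-(σ/2)AᴴA} Aᴴ)` and the two
  landed smoothing bounds (`stub_freeSmoothing`, `adjoint_smoothing`, each `≤ (eσ)^{-1/2}` in operator
  norm) give `‖A e^{-σAᴴA} Aᴴ w‖₂ ≤ (eσ)⁻¹ ‖w‖₂ ≤ Λ/e` for `‖w‖₂ ≤ Λσ`; at `u = b` the remainder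
  vanishes.  Minkowski's inequality in the landed duality form
  (`sqrt_sum_norm_sq_le_integral_of_forall_le`) with the constant majorant `Λ/e` bounds the remainder
  integral by `Λ(b − a)/e`.
* The two parts are recombined with the triangle inequality `sqrt_sum_norm_sq_add_le`.

Finite-dimensional linear algebra and one-variable calculus only; no named facts are used.
-/

noncomputable section

namespace Summit.QuantumFields.QCD.Cruxes.TracedQuadraticParametrix.Sketch

open Literature.MathematicalPhysics.QuantumLattice Literature.MathematicalPhysics.QuantumFieldTheory
  Literature.Probability.LatticeModels
open Summit.QuantumFields.QCD.Theses.HeatSlicedQuarks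
open Summit.QuantumFields.QCD.Cruxes.InterleavedHeatSliceFlow.Sketch
open Summit.QuantumFields.QCD.Cruxes.SmallFieldUltracontractivity.PointCentredAxialParabolic
open Summit.QuantumFields.QCD.Theorems.SmallFieldUltracontractivity.Negative
open MeasureTheory intervalIntegral
open scoped Matrix ComplexConjugate

variable {ι : Type} [Fintype ι] [DecidableEq ι]

/-! ### The frozen part: the kernel is an exact derivative -/

/-- The kernel is an exact `u`-derivative: `A e^{-(b−u)AᴴA} Aᴴ = (AAᴴ) e^{(u−b)AAᴴ}` (intertwining of the
adjoint through the heat semigroup, then the complex scalar multiple is a real one). -/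
private theorem maxReg_kernel_eq (A : Matrix ι ι ℂ) (b u : ℝ) :
    A * NormedSpace.exp (-((b - u : ℝ) : ℂ) • (Aᴴ * A)) * Aᴴ =
      A * Aᴴ * NormedSpace.exp ((u - b) • (A * Aᴴ)) := by
  rw [Matrix.mul_assoc, exp_conjTranspose_mul_self_mul_conjTranspose A (b - u), ← Matrix.mul_assoc,
    ← Complex.ofReal_neg, neg_sub, rowDuhamel_coe_smul]

/-- The kernel `u ↦ A e^{-(b−u)AᴴA} Aᴴ` is continuous (product topology on matrices). -/
private theorem maxReg_continuous_kernel (A : Matrix ι ι ℂ) (b : ℝ) :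
    Continuous fun u : ℝ => A * NormedSpace.exp (-((b - u : ℝ) : ℂ) • (Aᴴ * A)) * Aᴴ := by
  simp only [maxReg_kernel_eq]
  open scoped Matrix.Norms.Operator in
  fun_prop

/-- Entrywise, `u ↦ (e^{(u−b)AAᴴ}) i j` has derivative `(A e^{-(b−u)AᴴA} Aᴴ) i j`
(`hasDerivAt_exp_smul_const'` along the real ray, entry evaluation `rowDuhamel_hasDerivAt_apply`). -/
private theorem maxReg_hasDerivAt (A : Matrix ι ι ℂ) (b u : ℝ) (i j : ι) :
    HasDerivAt (fun v : ℝ => NormedSpace.exp ((v - b) • (A * Aᴴ)) i j)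
      ((A * NormedSpace.exp (-((b - u : ℝ) : ℂ) • (Aᴴ * A)) * Aᴴ) i j) u := by
  rw [maxReg_kernel_eq]
  open scoped Matrix.Norms.Operator in
  exact rowDuhamel_hasDerivAt_apply
    (HasDerivAt.comp_sub_const u b (hasDerivAt_exp_smul_const' (𝕂 := ℝ) (A * Aᴴ) (u - b))) i j

/-- The fundamental theorem of calculus for the kernel, entrywise:
`∫_a^b (A e^{-(b−u)AᴴA} Aᴴ) i j du = (1 − e^{-(b−a)AAᴴ}) i j`. -/
private theorem maxReg_integral_kernel (A : Matrix ι ι ℂ) (a b : ℝ) (i j : ι) :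
    ∫ u in a..b, (A * NormedSpace.exp (-((b - u : ℝ) : ℂ) • (Aᴴ * A)) * Aᴴ) i j =
      (1 - NormedSpace.exp (-((b - a : ℝ) : ℂ) • (A * Aᴴ))) i j := by
  have hint : IntervalIntegrable
      (fun u : ℝ => (A * NormedSpace.exp (-((b - u : ℝ) : ℂ) • (Aᴴ * A)) * Aᴴ) i j) volume a b :=
    ((maxReg_continuous_kernel A b).matrix_elem i j).intervalIntegrable a b
  have e : -((b - a : ℝ) : ℂ) • (A * Aᴴ) = (a - b) • (A * Aᴴ) := by
    rw [← Complex.ofReal_neg, neg_sub, rowDuhamel_coe_smul]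
  rw [intervalIntegral.integral_eq_sub_of_hasDerivAt (fun u _ => maxReg_hasDerivAt A b u i j) hint, e,
    sub_self, zero_smul, NormedSpace.exp_zero, Matrix.sub_apply]

/-- The frozen integral: `∫_a^b (A e^{-(b−u)AᴴA} Aᴴ w) i du = ((1 − e^{-(b−a)AAᴴ}) w) i` for a CONSTANT
vector `w` (finite sum of the entrywise identities `maxReg_integral_kernel`). -/
private theorem maxReg_integral_frozen (A : Matrix ι ι ℂ) (a b : ℝ) (w : ι → ℂ) (i : ι) :
    ∫ u in a..b, ((A * NormedSpace.exp (-((b - u : ℝ) : ℂ) • (Aᴴ * A)) * Aᴴ).mulVec w) i =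
      ((1 - NormedSpace.exp (-((b - a : ℝ) : ℂ) • (A * Aᴴ))).mulVec w) i := by
  simp only [Matrix.mulVec, dotProduct]
  rw [intervalIntegral.integral_finsetSum]
  · refine Finset.sum_congr rfl fun j _ => ?_
    rw [intervalIntegral.integral_mul_const, maxReg_integral_kernel A a b]
  · intro j _
    exact (((maxReg_continuous_kernel A b).matrix_elem i j).mul continuous_const).intervalIntegrable a b

/-- The frozen bound: `‖(1 − e^{-s AAᴴ}) w‖₂ ≤ 2‖w‖₂` for `s ≥ 0` (triangle inequality and the heat
contraction `heat_mulVec_contraction` for the matrix `Aᴴ`, whose T*T semigroup is `e^{-s AAᴴ}`). -/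
private theorem maxReg_frozen_bound (A : Matrix ι ι ℂ) {s : ℝ} (hs : 0 ≤ s) (w : ι → ℂ) :
    Real.sqrt (∑ i, ‖((1 - NormedSpace.exp (-(s : ℂ) • (A * Aᴴ))).mulVec w) i‖ ^ 2) ≤
      2 * Real.sqrt (∑ i, ‖w i‖ ^ 2) := by
  have hc := heat_mulVec_contraction Aᴴ hs w
  rw [Matrix.conjTranspose_conjTranspose] at hc
  have hsplit : (1 - NormedSpace.exp (-(s : ℂ) • (A * Aᴴ))).mulVec w =
      fun i => w i + -((NormedSpace.exp (-(s : ℂ) • (A * Aᴴ))).mulVec w i) := by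
    funext i
    rw [Matrix.sub_mulVec, Matrix.one_mulVec, Pi.sub_apply, sub_eq_add_neg]
  rw [hsplit]
  refine (sqrt_sum_norm_sq_add_le w _).trans ?_
  simp only [norm_neg]
  rw [two_mul]
  exact add_le_add le_rfl (Real.sqrt_le_sqrt hc)

/-! ### The remainder: two half-smoothings against the Lipschitz modulus -/

/-- `‖A e^{-σAᴴA} Aᴴ w‖₂² ≤ (eσ)⁻² ‖w‖₂²` for `σ > 0`: split `e^{-σAᴴA} = e^{-(σ/2)AᴴA} e^{-(σ/2)AᴴA}`
and use `stub_freeSmoothing` for `A e^{-(σ/2)AᴴA}` and `adjoint_smoothing` for `e^{-(σ/2)AᴴA} Aᴴ`. -/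
private theorem maxReg_kernel_mulVec_bound (A : Matrix ι ι ℂ) {σ : ℝ} (hσ : 0 < σ) (w : ι → ℂ) :
    ∑ i, ‖((A * NormedSpace.exp (-(σ : ℂ) • (Aᴴ * A)) * Aᴴ).mulVec w) i‖ ^ 2 ≤
      (Real.exp 1 * σ)⁻¹ ^ 2 * ∑ i, ‖w i‖ ^ 2 := by
  have h2 : 0 < σ / 2 := by positivity
  -- adapted from `exp_neg_smul_eq_sq` in HeatSlicedQuarksInterleavedHeatSliceFlowStubInteriorAssembly.lean
  have hsq : NormedSpace.exp (-(σ : ℂ) • (Aᴴ * A)) =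
      NormedSpace.exp (-((σ / 2 : ℝ) : ℂ) • (Aᴴ * A)) *
        NormedSpace.exp (-((σ / 2 : ℝ) : ℂ) • (Aᴴ * A)) := by
    have hsum : -(σ : ℂ) • (Aᴴ * A) = -((σ / 2 : ℝ) : ℂ) • (Aᴴ * A) + -((σ / 2 : ℝ) : ℂ) • (Aᴴ * A) := by
      rw [← add_smul]; congr 1; push_cast; ring
    rw [hsum, Matrix.exp_add_of_commute _ _ (Commute.refl _)]
  have hfac : A * NormedSpace.exp (-(σ : ℂ) • (Aᴴ * A)) * Aᴴ =
      A * NormedSpace.exp (-((σ / 2 : ℝ) : ℂ) • (Aᴴ * A)) *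
        (NormedSpace.exp (-((σ / 2 : ℝ) : ℂ) • (Aᴴ * A)) * Aᴴ) := by
    rw [hsq]; simp only [Matrix.mul_assoc]
  rw [hfac, ← Matrix.mulVec_mulVec]
  have hA := stub_freeSmoothing ι A (σ / 2) h2
    ((NormedSpace.exp (-((σ / 2 : ℝ) : ℂ) • (Aᴴ * A)) * Aᴴ).mulVec w)
  have hB := adjoint_smoothing A h2 w
  have hc : (2 * Real.exp 1 * (σ / 2))⁻¹ = (Real.exp 1 * σ)⁻¹ := by
    congr 1; ring
  rw [hc] at hA hB
  have h0 : 0 ≤ (Real.exp 1 * σ)⁻¹ := inv_nonneg.mpr (by positivity)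
  calc ∑ i, ‖((A * NormedSpace.exp (-((σ / 2 : ℝ) : ℂ) • (Aᴴ * A))).mulVec
          (((NormedSpace.exp (-((σ / 2 : ℝ) : ℂ) • (Aᴴ * A)) * Aᴴ).mulVec w))) i‖ ^ 2
      ≤ (Real.exp 1 * σ)⁻¹ *
          ∑ i, ‖((NormedSpace.exp (-((σ / 2 : ℝ) : ℂ) • (Aᴴ * A)) * Aᴴ).mulVec w) i‖ ^ 2 := hA
    _ ≤ (Real.exp 1 * σ)⁻¹ * ((Real.exp 1 * σ)⁻¹ * ∑ i, ‖w i‖ ^ 2) :=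
        mul_le_mul_of_nonneg_left hB h0
    _ = (Real.exp 1 * σ)⁻¹ ^ 2 * ∑ i, ‖w i‖ ^ 2 := by ring

/-- The pointwise remainder bound: if `u ≤ b`, `Λ ≥ 0` and `‖w‖₂ ≤ Λ (b − u)`, then
`‖A e^{-(b−u)AᴴA} Aᴴ w‖₂ ≤ Λ/e` (for `u < b` by `maxReg_kernel_mulVec_bound`; for `u = b`, `w = 0`). -/
private theorem maxReg_remainder_pointwise (A : Matrix ι ι ℂ) {b u Λ : ℝ} (hΛ : 0 ≤ Λ) (hu : u ≤ b)
    (w : ι → ℂ) (hw : Real.sqrt (∑ j, ‖w j‖ ^ 2) ≤ Λ * (b - u)) :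
    Real.sqrt (∑ i, ‖((A * NormedSpace.exp (-((b - u : ℝ) : ℂ) • (Aᴴ * A)) * Aᴴ).mulVec w) i‖ ^ 2) ≤
      Λ / Real.exp 1 := by
  rcases eq_or_lt_of_le hu with rfl | hlt
  · -- `u = b`: the modulus forces `w = 0`
    have hw' := hw
    rw [sub_self, mul_zero] at hw'
    have hS0 : ∑ j, ‖w j‖ ^ 2 = 0 :=
      le_antisymm (Real.sqrt_eq_zero'.1 (le_antisymm hw' (Real.sqrt_nonneg _)))
        (Finset.sum_nonneg fun j _ => by positivity)
    have hw0 : w = 0 := by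
      funext j
      have hj := (Finset.sum_eq_zero_iff_of_nonneg fun j _ => by positivity).1 hS0 j (Finset.mem_univ j)
      exact norm_eq_zero.1 ((pow_eq_zero_iff two_ne_zero).1 hj)
    rw [hw0, Matrix.mulVec_zero]
    simp only [Pi.zero_apply, norm_zero, ne_eq, OfNat.ofNat_ne_zero, not_false_eq_true, zero_pow,
      Finset.sum_const_zero, Real.sqrt_zero]
    exact div_nonneg hΛ (Real.exp_nonneg 1)
  · have hσ : 0 < b - u := sub_pos.mpr hlt
    have h := maxReg_kernel_mulVec_bound A hσ w
    have h0 : 0 ≤ (Real.exp 1 * (b - u))⁻¹ := inv_nonneg.mpr (by positivity)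
    have he : 0 < Real.exp 1 := Real.exp_pos 1
    calc Real.sqrt (∑ i, ‖((A * NormedSpace.exp (-((b - u : ℝ) : ℂ) • (Aᴴ * A)) * Aᴴ).mulVec w) i‖ ^ 2)
        ≤ Real.sqrt ((Real.exp 1 * (b - u))⁻¹ ^ 2 * ∑ i, ‖w i‖ ^ 2) := Real.sqrt_le_sqrt h
      _ = (Real.exp 1 * (b - u))⁻¹ * Real.sqrt (∑ i, ‖w i‖ ^ 2) := by
          rw [Real.sqrt_mul (sq_nonneg _), Real.sqrt_sq h0]
      _ ≤ (Real.exp 1 * (b - u))⁻¹ * (Λ * (b - u)) := mul_le_mul_of_nonneg_left hw h0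
      _ = Λ / Real.exp 1 := by
          field_simp

/-! ### Continuity of the integrands and the assembly -/

/-- Continuity on `[a,b]` of the entries of `u ↦ A e^{-(b−u)AᴴA} Aᴴ g(u)` for an entrywise continuous
vector curve `g`. -/
private theorem maxReg_continuousOn_mulVec (A : Matrix ι ι ℂ) {a b : ℝ} {g : ℝ → ι → ℂ}
    (hg : ∀ j, ContinuousOn (fun u => g u j) (Set.Icc a b)) (i : ι) :
    ContinuousOn
      (fun u => ((A * NormedSpace.exp (-((b - u : ℝ) : ℂ) • (Aᴴ * A)) * Aᴴ).mulVec (g u)) i)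
      (Set.Icc a b) := by
  simp only [Matrix.mulVec, dotProduct]
  exact continuousOn_finsetSum _ fun j _ =>
    ((maxReg_continuous_kernel A b).matrix_elem i j).continuousOn.mul (hg j)

/-- **Parabolic maximal regularity by freezing** (registered stub `stub_maximalRegularity` of line
`Sketch`; see the module docstring): for a square complex matrix `A`, `a < b`, an entrywise continuous
vector curve `f` on `[a,b]` with `‖f(u) − f(b)‖₂ ≤ Λ (b − u)` (`Λ ≥ 0`),
`‖∫_a^b A e^{-(b−u)AᴴA} Aᴴ f(u) du‖₂ ≤ 2 ‖f(b)‖₂ + Λ (b − a)/e`. -/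
theorem stub_maximalRegularity :
    ∀ (ι : Type) [Fintype ι] [DecidableEq ι] (A : Matrix ι ι ℂ) (a b : ℝ), a < b →
    ∀ (f : ℝ → ι → ℂ) (Λ : ℝ), 0 ≤ Λ →
    (∀ j, ContinuousOn (fun u => f u j) (Set.Icc a b)) →
    (∀ u ∈ Set.Icc a b, Real.sqrt (∑ j, ‖f u j - f b j‖ ^ 2) ≤ Λ * (b - u)) →
    Real.sqrt (∑ i, ‖∫ u in a..b,
        ((A * NormedSpace.exp (-((b - u : ℝ) : ℂ) • (Aᴴ * A)) * Aᴴ).mulVec (f u)) i‖ ^ 2) ≤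
      2 * Real.sqrt (∑ j, ‖f b j‖ ^ 2) + Λ * (b - a) / Real.exp 1 := by
  intro ι _ _ A a b hab f Λ hΛ hf hmod
  -- continuity of the frozen and remainder curves
  have hbc : ∀ j, ContinuousOn (fun _ : ℝ => f b j) (Set.Icc a b) := fun j => continuousOn_const
  have hgc : ∀ j, ContinuousOn (fun u => f u j - f b j) (Set.Icc a b) := fun j =>
    (hf j).sub continuousOn_const
  -- interval integrability of the two pieces
  have hint1 : ∀ i, IntervalIntegrable (fun u =>
      ((A * NormedSpace.exp (-((b - u : ℝ) : ℂ) • (Aᴴ * A)) * Aᴴ).mulVec (f b)) i) volume a b :=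
    fun i => (maxReg_continuousOn_mulVec A (g := fun _ => f b) hbc i).intervalIntegrable_of_Icc hab.le
  have hint2 : ∀ i, IntervalIntegrable (fun u =>
      ((A * NormedSpace.exp (-((b - u : ℝ) : ℂ) • (Aᴴ * A)) * Aᴴ).mulVec (fun j => f u j - f b j)) i)
        volume a b :=
    fun i => (maxReg_continuousOn_mulVec A (g := fun u j => f u j - f b j) hgc i).intervalIntegrable_of_Icc
      hab.le
  -- pointwise freezing `f(u) = f(b) + (f(u) − f(b))`
  have hsplit : ∀ (u : ℝ) (i : ι),
      ((A * NormedSpace.exp (-((b - u : ℝ) : ℂ) • (Aᴴ * A)) * Aᴴ).mulVec (f u)) i =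
        ((A * NormedSpace.exp (-((b - u : ℝ) : ℂ) • (Aᴴ * A)) * Aᴴ).mulVec (f b)) i +
          ((A * NormedSpace.exp (-((b - u : ℝ) : ℂ) • (Aᴴ * A)) * Aᴴ).mulVec
            (fun j => f u j - f b j)) i := by
    intro u i
    have hfu : (fun j => f u j - f b j) = f u - f b := rfl
    rw [hfu, Matrix.mulVec_sub, Pi.sub_apply]
    ring
  -- the integral splits into the frozen part and the remainder
  have hI : ∀ i, ∫ u in a..b, ((A * NormedSpace.exp (-((b - u : ℝ) : ℂ) • (Aᴴ * A)) * Aᴴ).mulVec (f u)) i =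
      ((1 - NormedSpace.exp (-((b - a : ℝ) : ℂ) • (A * Aᴴ))).mulVec (f b)) i +
        ∫ u in a..b, ((A * NormedSpace.exp (-((b - u : ℝ) : ℂ) • (Aᴴ * A)) * Aᴴ).mulVec
          (fun j => f u j - f b j)) i := by
    intro i
    simp_rw [hsplit]
    rw [intervalIntegral.integral_add (hint1 i) (hint2 i), maxReg_integral_frozen A a b]
  -- the frozen bound
  have hP : Real.sqrt (∑ i, ‖((1 - NormedSpace.exp (-((b - a : ℝ) : ℂ) • (A * Aᴴ))).mulVec (f b)) i‖ ^ 2) ≤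
      2 * Real.sqrt (∑ j, ‖f b j‖ ^ 2) :=
    maxReg_frozen_bound A (sub_nonneg.mpr hab.le) (f b)
  -- the remainder bound (Minkowski by duality with the constant majorant `Λ/e`)
  have hR : Real.sqrt (∑ i, ‖∫ u in a..b, ((A * NormedSpace.exp (-((b - u : ℝ) : ℂ) • (Aᴴ * A)) * Aᴴ).mulVec
      (fun j => f u j - f b j)) i‖ ^ 2) ≤ Λ * (b - a) / Real.exp 1 := by
    have h := sqrt_sum_norm_sq_le_integral_of_forall_le
      (fun i => ∫ u in a..b, ((A * NormedSpace.exp (-((b - u : ℝ) : ℂ) • (Aᴴ * A)) * Aᴴ).mulVec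
        (fun j => f u j - f b j)) i)
      (fun u i => ((A * NormedSpace.exp (-((b - u : ℝ) : ℂ) • (Aᴴ * A)) * Aᴴ).mulVec
        (fun j => f u j - f b j)) i)
      (fun _ => Λ / Real.exp 1) hab.le
      (fun j => maxReg_continuousOn_mulVec A (g := fun u j => f u j - f b j) hgc j) continuousOn_const
      (fun _ => rfl) (fun u hu => maxReg_remainder_pointwise A hΛ hu.2 _ (hmod u hu))
    rw [intervalIntegral.integral_const, smul_eq_mul] at h
    refine h.trans (le_of_eq ?_)
    ring
  -- assemble with the triangle inequality
  calc Real.sqrt (∑ i, ‖∫ u in a..b,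
          ((A * NormedSpace.exp (-((b - u : ℝ) : ℂ) • (Aᴴ * A)) * Aᴴ).mulVec (f u)) i‖ ^ 2)
      = Real.sqrt (∑ i, ‖((1 - NormedSpace.exp (-((b - a : ℝ) : ℂ) • (A * Aᴴ))).mulVec (f b)) i +
          ∫ u in a..b, ((A * NormedSpace.exp (-((b - u : ℝ) : ℂ) • (Aᴴ * A)) * Aᴴ).mulVec
            (fun j => f u j - f b j)) i‖ ^ 2) := by
        simp_rw [hI]
    _ ≤ Real.sqrt (∑ i, ‖((1 - NormedSpace.exp (-((b - a : ℝ) : ℂ) • (A * Aᴴ))).mulVec (f b)) i‖ ^ 2) +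
          Real.sqrt (∑ i, ‖∫ u in a..b,
            ((A * NormedSpace.exp (-((b - u : ℝ) : ℂ) • (Aᴴ * A)) * Aᴴ).mulVec
              (fun j => f u j - f b j)) i‖ ^ 2) :=
        sqrt_sum_norm_sq_add_le _ _
    _ ≤ 2 * Real.sqrt (∑ j, ‖f b j‖ ^ 2) + Λ * (b - a) / Real.exp 1 := add_le_add hP hR

end Summit.QuantumFields.QCD.Cruxes.TracedQuadraticParametrix.Sketch

end
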